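import Literature.AnabelianGeometry.EtaleTheta.SettingModelGfpRigidity
import HarnessLib

/-!
# Topological automorphisms of `Γ = F̂₂ ×_Ẑ ℤ` preserve the level kernels `Ker ĥ_N` (`N` odd)

Mochizuki, *The étale theta function …*, Publ. RIMS **45** (2009) [EtTh], §1, PRIMS PDF pp. 12–14
(«`Δ^Θ_X := Δ_X/[Δ_X,[Δ_X,Δ_X]]`», the coverings «`Z_N → Y_N → X`» with `Δ^tp_{Z_N} = Ker pr₂ ∩ Ker ĥ_N`)
[cite: MochizukiEtTh2009, §1 p.12]; the universal property of the Heisenberg group is classical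
(the free class-`2`, exponent-`N` group on two generators IS `Heis (ℤ/N)` for odd `N`). [folklore]

abc-iut cell, layer L6 / K-L6 row «HEXT-DECIDE@modelχq», sub-row R5-1 «HEXT-LEVELKER-TEST» (K2)
(abc-iut-L6-lead §F v1.19du (B2) / v1.19dw (A)), seat abc-iut-L6-t13 (gen 12).  PROOF-ONLY companion of
abc-iut-L2-t1's finer model files `SettingModel2Curve` (`Gfp`, `gfpFst`, `isProfiniteCompletion_gfpFst`),
`SettingModel2Theta` (`hHat`), `SettingModel2Coverings` (`levelHom`, `dZ`) and of abc-iut-w5-d051's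
`SettingModelGfpRigidity` (`map_dY_eq`): no definition, no instance, no `Prop`-valued fact; every input is
consumed BY NAME.

WHAT THIS FILE PROVES (numbers, not adjectives).
* §1 `Heis.exists_monoidHom_apply_gen_eq` — **universal property of `Heis R` when `2` is invertible in
  `R`** (`2·u = 1`): for ALL `h₁ h₂ : Heis R` there is an endomorphism `ε` with `ε (1,0,0) = h₁`,
  `ε (0,1,0) = h₂`; explicitly `(x,y,z) ↦ (a₁x+a₂y, b₁x+b₂y, c₁′x+c₂′y+(a₁b₂−a₂b₁)z+u·a₁b₁x²+a₂b₁xy+u·a₂b₂y²)`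
  with `cᵢ′ = cᵢ − u·aᵢbᵢ` (the hom law is ONE `linear_combination`).  No verbal-subgroup theory.
* §2 `exists_monoidHom_hHat_comp_eq` — for EVERY continuous endomorphism `Φ` of `F̂₂` and every `N` with
  `2 ∈ (ℤ/N)^×` there is an endomorphism `ε` of `Heis (ℤ/N)` with `ĥ_N ∘ Φ = ε ∘ ĥ_N` (two continuous maps to
  the discrete `Heis (ℤ/N)` agreeing on the dense `η(F₂)`, where they agree by §1 on the two generators);
  hence `hHat_apply_eq_one_of` : `Φ (Ker ĥ_N) ⊆ Ker ĥ_N` — «`Ker(F̂₂ ↠ Heis(ℤ/N))` is topologically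
  characteristic (indeed fully invariant) for odd `N`».
* §3 `exists_monoidHom_levelHom_comp_eq` / `apply_mem_ker_levelHom_of` — for every continuous endomorphism
  `φ` of `Γ` (extend `pr₁ ∘ φ` along the profinite completion `pr₁`, abc-iut-w5-d139's
  `IsProfiniteCompletion.exists_extension`, exactly as in `map_dY_eq`): `levelHom N ∘ φ = ε ∘ levelHom N`
  and `φ (Ker levelHom N) ⊆ Ker levelHom N` (`N` odd); for topological automorphisms `γ : Γ ≃ₜ* Γ`:
  `map_ker_levelHom_eq`, `apply_mem_ker_levelHom_iff`, and `map_dZ_eq` / `apply_mem_dZ_iff`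
  (`Δ^tp_{Z_N} = Ker pr₂ ∩ Ker ĥ_N` is mapped ONTO itself — the geometric half of «`γ(Π^tp_{Z_N}) = Π^tp_{Z_N}`»
  at every ODD level, with NO origin clause).
SCOPE: all odd `N` at once; the even-`N` case is genuinely different (`Heis (ℤ/2^k)` has exponent
`2^{k+1}`, so it is not relatively free of exponent `2^k`) and is NOT claimed here.

HONEST LABEL: statements about abc-iut-L2-t1's SEMI-SYNTHETIC model `Γ = F̂₂ ×_Ẑ ℤ` of the typed [EtTh] §1
interface (consistency / binder-satisfiability evidence for OUR typing only, not the tempered fundamental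
group of a curve); nothing of [EtTh] is asserted beyond the tree's proofs; no side is taken on
[IUTchIII] Cor. 3.12; typed ≠ proved; nothing here says abc is proved or refuted.
-/

noncomputable section

namespace Literature.AnabelianGeometry.EtaleTheta.SettingModel

open Literature.AnabelianGeometry.SemiGraphs Function Topology

/-! ### §1. The universal property of `Heis R` when `2` is invertible -/

namespace Heis

variable {R : Type*} [CommRing R]

/-- **Universal property of the Heisenberg group over a ring in which `2·u = 1`**: every pair
`h₁, h₂ ∈ Heis R` is the image of the two standard generators `(1,0,0)`, `(0,1,0)` under an endomorphism
of `Heis R` — i.e. `Heis R` is (relatively) free on its two generators among class-`2` groups of this shape;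
for `R = ℤ/N`, `N` odd, this is the statement that `Heis (ℤ/N)` is the free class-`2` exponent-`N` group on
two generators («the finite class-`2` quotients `Δ^Θ_X ↠ Heis (ℤ/N)`», [EtTh] §1 p. 12).  The endomorphism is
written in coordinates (see the file header); classical. [cite: MochizukiEtTh2009, §1 p.12] -/
theorem exists_monoidHom_apply_gen_eq (u : R) (hu : 2 * u = 1) (h₁ h₂ : Heis R) :
    ∃ ε : Heis R →* Heis R, ε ⟨1, 0, 0⟩ = h₁ ∧ ε ⟨0, 1, 0⟩ = h₂ := by
  refine ⟨{ toFun := fun g =>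
              ⟨h₁.x * g.x + h₂.x * g.y,
               h₁.y * g.x + h₂.y * g.y,
               (h₁.z - u * (h₁.x * h₁.y)) * g.x + (h₂.z - u * (h₂.x * h₂.y)) * g.y
                 + (h₁.x * h₂.y - h₂.x * h₁.y) * g.z
                 + u * (h₁.x * h₁.y) * (g.x * g.x) + h₂.x * h₁.y * (g.x * g.y)
                 + u * (h₂.x * h₂.y) * (g.y * g.y)⟩
            map_one' := by ext <;> simp
            map_mul' := fun a b => by
              ext
              · simp only [mul_x, mul_y]; ring
              · simp only [mul_x, mul_y]; ring
              · simp only [mul_x, mul_y, mul_z]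
                linear_combination (h₁.x * h₁.y * (a.x * b.x) + h₂.x * h₂.y * (a.y * b.y)) * hu },
    ?_, ?_⟩
  · ext
    · simp
    · simp
    · simp only [MonoidHom.coe_mk, OneHom.coe_mk]; ring
  · ext
    · simp
    · simp
    · simp only [MonoidHom.coe_mk, OneHom.coe_mk]; ring

end Heis

/-- In `ℤ/N` with `N` odd, `2` is invertible. [folklore] -/
private theorem exists_two_mul_eq_one_zmod (N : ℕ+) (hN : Odd (N : ℕ)) : ∃ u : ZMod N, 2 * u = 1 := by
  obtain ⟨k, hk⟩ := hN
  refine ⟨((k : ℕ) : ZMod N) + 1, ?_⟩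
  have h0 : ((2 * k + 1 : ℕ) : ZMod N) = 0 := by rw [← hk]; exact ZMod.natCast_self N
  push_cast at h0
  linear_combination h0

/-! ### §2. Continuous endomorphisms of `F̂₂` act on `ĥ_N` through endomorphisms of `Heis (ℤ/N)` -/

/-- `ĥ_N (η a) = (1,0,0)`. [cite: MochizukiEtTh2009, §1 p.12] -/
theorem hHat_eta_of_zero (N : ℕ+) : hHat N (eta (FreeGroup.of 0)) = ⟨1, 0, 0⟩ := by
  rw [hHat_eta, heisHom_of_zero, Heis.map_apply]
  ext <;> simp

/-- `ĥ_N (η b) = (0,1,0)`. [cite: MochizukiEtTh2009, §1 p.12] -/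
theorem hHat_eta_of_one (N : ℕ+) : hHat N (eta (FreeGroup.of 1)) = ⟨0, 1, 0⟩ := by
  rw [hHat_eta, heisHom_of_one, Heis.map_apply]
  ext <;> simp

/-- **Every continuous endomorphism `Φ` of `F̂₂` acts on the level map `ĥ_N` through an endomorphism of
`Heis (ℤ/N)`** whenever `2` is invertible mod `N`: `ĥ_N (Φ x) = ε (ĥ_N x)` for the endomorphism `ε` of §1
sending the generators to `ĥ_N (Φ (η a))`, `ĥ_N (Φ (η b))` (both sides are continuous homomorphisms to the
discrete group `Heis (ℤ/N)` agreeing on the dense `η(F₂)`). [cite: MochizukiEtTh2009, §1 p.12] -/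
theorem exists_monoidHom_hHat_comp_eq (Φ : F₂hatT →ₜ* F₂hatT) (N : ℕ+) {u : ZMod N} (hu : 2 * u = 1) :
    ∃ ε : Heis (ZMod N) →* Heis (ZMod N), ∀ x : F₂hatT, hHat N (Φ x) = ε (hHat N x) := by
  obtain ⟨ε, h0, h1⟩ := Heis.exists_monoidHom_apply_gen_eq u hu
    (hHat N (Φ (eta (FreeGroup.of 0)))) (hHat N (Φ (eta (FreeGroup.of 1))))
  refine ⟨ε, fun x => ?_⟩
  -- the two composites agree on the generators of `F₂`, hence on `F₂`
  have hgen : ((hHat N).toMonoidHom.comp (Φ.toMonoidHom.comp eta)) =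
      ε.comp ((hHat N).toMonoidHom.comp eta) := by
    refine FreeGroup.ext_hom _ _ fun a => ?_
    fin_cases a
    · change hHat N (Φ (eta (FreeGroup.of 0))) = ε (hHat N (eta (FreeGroup.of 0)))
      rw [hHat_eta_of_zero, h0]
    · change hHat N (Φ (eta (FreeGroup.of 1))) = ε (hHat N (eta (FreeGroup.of 1)))
      rw [hHat_eta_of_one, h1]
  -- two continuous maps to the discrete `Heis (ℤ/N)` agreeing on the dense `η(F₂)`
  have key : (fun x => hHat N (Φ x)) = fun x => ε (hHat N x) := by
    refine denseRange_eta.equalizer ((hHat N).continuous.comp Φ.continuous)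
      ((continuous_of_discreteTopology (f := ε)).comp (hHat N).continuous) ?_
    funext g
    exact DFunLike.congr_fun hgen g
  exact congrFun key x

/-- **`Ker ĥ_N` is stable under every continuous endomorphism of `F̂₂`** (`N` odd): «`Ker(F̂₂ ↠ Heis(ℤ/N))`
is topologically characteristic — indeed fully invariant — for odd `N`». [cite: MochizukiEtTh2009, §1 p.12] -/
theorem hHat_apply_eq_one_of (Φ : F₂hatT →ₜ* F₂hatT) (N : ℕ+) (hN : Odd (N : ℕ)) {x : F₂hatT}
    (hx : hHat N x = 1) : hHat N (Φ x) = 1 := by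
  obtain ⟨u, hu⟩ := exists_two_mul_eq_one_zmod N hN
  obtain ⟨ε, hε⟩ := exists_monoidHom_hHat_comp_eq Φ N hu
  rw [hε x, hx, map_one]

/-! ### §3. Topological endomorphisms and automorphisms of `Γ` preserve `Ker (levelHom N)` and `Δ^tp_{Z_N}` -/

/-- **Every continuous endomorphism `φ` of `Γ` acts on `levelHom N` through an endomorphism of
`Heis (ℤ/N)`** (`N` odd): extend `pr₁ ∘ φ` along the profinite completion `pr₁ : Γ → F̂₂` and apply §2.
[cite: MochizukiEtTh2009, §1 p.13] -/
theorem exists_monoidHom_levelHom_comp_eq (φ : Gfp →ₜ* Gfp) (N : ℕ+) (hN : Odd (N : ℕ)) :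
    ∃ ε : Heis (ZMod N) →* Heis (ZMod N), ∀ q : Gfp, levelHom N (φ q) = ε (levelHom N q) := by
  obtain ⟨u, hu⟩ := exists_two_mul_eq_one_zmod N hN
  obtain ⟨Φ, hΦ⟩ := isProfiniteCompletion_gfpFst.exists_extension
    (⟨gfpFst.toMonoidHom.comp φ.toMonoidHom, gfpFst.continuous.comp φ.continuous⟩ : Gfp →ₜ* F₂hatT)
  obtain ⟨ε, hε⟩ := exists_monoidHom_hHat_comp_eq Φ N hu
  refine ⟨ε, fun q => ?_⟩
  have e : gfpFst (φ q) = Φ (gfpFst q) := (hΦ q).symm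
  change hHat N (gfpFst (φ q)) = ε (hHat N (gfpFst q))
  rw [e, hε]

/-- **Every continuous endomorphism of `Γ` maps `Ker (levelHom N)` into itself** (`N` odd).
[cite: MochizukiEtTh2009, §1 p.14] -/
theorem apply_mem_ker_levelHom_of (φ : Gfp →ₜ* Gfp) (N : ℕ+) (hN : Odd (N : ℕ)) {q : Gfp}
    (hq : q ∈ (levelHom N).ker) : φ q ∈ (levelHom N).ker := by
  obtain ⟨ε, hε⟩ := exists_monoidHom_levelHom_comp_eq φ N hN
  rw [MonoidHom.mem_ker] at hq ⊢
  rw [hε q, hq, map_one]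

/-- The subgroup form: `φ (Ker levelHom N) ≤ Ker levelHom N` for a continuous endomorphism `φ` of `Γ`
(`N` odd). [cite: MochizukiEtTh2009, §1 p.14] -/
theorem map_ker_levelHom_le (φ : Gfp →ₜ* Gfp) (N : ℕ+) (hN : Odd (N : ℕ)) :
    (levelHom N).ker.map φ.toMonoidHom ≤ (levelHom N).ker := by
  rintro _ ⟨q, hq, rfl⟩
  exact apply_mem_ker_levelHom_of φ N hN hq

/-- A topological automorphism of `Γ` as a continuous endomorphism. [folklore] -/
private theorem map_ker_levelHom_le_of_continuousMulEquiv (γ : Gfp ≃ₜ* Gfp) (N : ℕ+) (hN : Odd (N : ℕ)) :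
    (levelHom N).ker.map γ.toMulEquiv.toMonoidHom ≤ (levelHom N).ker := by
  rintro _ ⟨q, hq, rfl⟩
  exact apply_mem_ker_levelHom_of (⟨γ.toMulEquiv.toMonoidHom, γ.continuous⟩ : Gfp →ₜ* Gfp) N hN hq

/-- **Every topological automorphism of `Γ` maps `Ker (levelHom N)` ONTO itself** (`N` odd).
[cite: MochizukiEtTh2009, §1 p.14] -/
theorem map_ker_levelHom_eq (γ : Gfp ≃ₜ* Gfp) (N : ℕ+) (hN : Odd (N : ℕ)) :
    (levelHom N).ker.map γ.toMulEquiv.toMonoidHom = (levelHom N).ker := by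
  refine le_antisymm (map_ker_levelHom_le_of_continuousMulEquiv γ N hN) fun q hq => ?_
  exact ⟨γ.symm q, map_ker_levelHom_le_of_continuousMulEquiv γ.symm N hN ⟨q, hq, rfl⟩,
    γ.apply_symm_apply q⟩

/-- Membership form: `γ q ∈ Ker levelHom N ↔ q ∈ Ker levelHom N` (`N` odd).
[cite: MochizukiEtTh2009, §1 p.14] -/
theorem apply_mem_ker_levelHom_iff (γ : Gfp ≃ₜ* Gfp) (N : ℕ+) (hN : Odd (N : ℕ)) (q : Gfp) :
    γ q ∈ (levelHom N).ker ↔ q ∈ (levelHom N).ker := by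
  constructor
  · intro h
    have h' := apply_mem_ker_levelHom_of
      (⟨γ.symm.toMulEquiv.toMonoidHom, γ.symm.continuous⟩ : Gfp →ₜ* Gfp) N hN h
    change γ.symm (γ q) ∈ _ at h'
    rwa [γ.symm_apply_apply] at h'
  · exact fun h => apply_mem_ker_levelHom_of (⟨γ.toMulEquiv.toMonoidHom, γ.continuous⟩ : Gfp →ₜ* Gfp) N hN h

/-- **Every topological automorphism of `Γ` maps `Δ^tp_{Z_N} = Ker pr₂ ∩ Ker ĥ_N` ONTO itself** (`N` odd):
the geometric half of «`γ(Π^tp_{Z_N}) = Π^tp_{Z_N}`» at every odd level, with NO origin clause (combine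
abc-iut-w5-d051's `map_ker_gfpSnd_eq` with `map_ker_levelHom_eq`). [cite: MochizukiEtTh2009, §1 p.14] -/
theorem apply_mem_dZ_iff (γ : Gfp ≃ₜ* Gfp) (N : ℕ+) (hN : Odd (N : ℕ)) (q : Gfp) :
    γ q ∈ dZ N ↔ q ∈ dZ N := by
  change γ q ∈ gfpSnd.ker ⊓ (levelHom N).ker ↔ q ∈ gfpSnd.ker ⊓ (levelHom N).ker
  rw [Subgroup.mem_inf, Subgroup.mem_inf, apply_mem_ker_gfpSnd_iff, apply_mem_ker_levelHom_iff γ N hN]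

/-- Subgroup form of `apply_mem_dZ_iff`. [cite: MochizukiEtTh2009, §1 p.14] -/
theorem map_dZ_eq (γ : Gfp ≃ₜ* Gfp) (N : ℕ+) (hN : Odd (N : ℕ)) :
    (dZ N).map γ.toMulEquiv.toMonoidHom = dZ N := by
  ext q
  constructor
  · rintro ⟨r, hr, rfl⟩
    exact (apply_mem_dZ_iff γ N hN r).mpr hr
  · intro hq
    exact ⟨γ.symm q, (apply_mem_dZ_iff γ.symm N hN q).mpr hq, γ.apply_symm_apply q⟩

end Literature.AnabelianGeometry.EtaleTheta.SettingModel
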